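import Literature.Computability.Cryptography.LWEModulusSwitchDiscrete
import Literature.Algebra.EuclideanLattices.FineGridGaussian
import HarnessLib

/-!
# BLPRS 2013, Cor. 3.2 between discretised interfaces: the one-sample chain in SAMPLING FORM (what a machine draws)

Topic `Computability/Cryptography` (LWE), grouping namespace `BLPRS2013`; sequel of
`LWEModulusSwitchDiscrete.lean` (the point kernel `switchPoint` of the chain re-continuise → switch the
modulus (Lemma 3.5, `LWEModulusSwitch.lean`) → post-process (secret shift `t`, noise raising `τ`,
`LWETorusPostprocess.lean`) → discretise, on one discretised sample `(a, b̄) ∈ ℤ_Qⁿ × ℤ_Q`) and of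
`Algebra/EuclideanLattices/FineGridGaussian.lean` (**`discreteGaussian_fineGrid_eq_map`**: the discrete
Gaussian of the grid `q'⁻¹ℤⁿ` factorises into scaled one-dimensional discrete Gaussians on the integer
numerators). Proved glue (no named fact) towards the MACHINE of hypothesis `h₃` of `BLPRSReduction.lean`
(pqc.S21): the law `switchPoint (a, b̄)` — defined through measures on `ℤ_{q'}ⁿ × 𝕋` with a lattice
Gaussian, a continuous Gaussian `e'`, a wrapped Gaussian `e` and a uniform jitter `u` — IS the law of the
following finite recipe, which is what a coin-driven program samples (each ingredient by a sampler of the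
tree: `GaussRejMachine.rejOf` for the integers `kⱼ`, the pseudo-Gaussian sampler for `w`, coin bits for `u`):

  `kⱼ ← D_{ℤ, q'r, q'·aⱼ/Q}` independently (`aⱼ ∈ {0,…,Q-1}` the lift),  `a' := k mod q'`,
  `u ← U[-½, ½)`, `w ← D_σ` with `σ² = (rB)² + τ²`,
  `b̄' := ⟨a', t⟩ + ⌊q'·b̄/Q + q'·u/Q + q'·w⌉ mod q'`.

* `contNoise σ` (the joint law of `(u, w)`), `roundMap`, `roundLaw c σ` (the law of `⌊c + q'u/Q + q'w⌉ mod q'`),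
  **`samplingPMF`** (the recipe as a `PMF`);
* `num_fineGridEquiv`, `torusClass_fineGridEquiv` (`class(k/q') = k mod q'`), `discretize_recipe`
  (the torus arithmetic of the chain collapses to `⟨a',t⟩ + roundMap`), the measurability lemmas, and
  **`switchPoint_eq_samplingPMF`**: `switchPoint n Q q' r B τ t (a, b̄) = (samplingPMF … (a, b̄)).toMeasure`
  (`0 < r`); hence `switchKernelPMF` / `switchOutputs` of `LWEModulusSwitchDiscrete.lean` are products of
  `samplingPMF` (`switchOutputs_eq_pi_samplingPMF`).

## References

* Z. Brakerski, A. Langlois, C. Peikert, O. Regev, D. Stehlé, *Classical hardness of learning with errors*,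
  STOC 2013; arXiv:1306.0281, Lemma 3.5 (the map: "choose `f ← D_{Λ-a,r}` … `e' ← D_{rB}`"), Cor. 3.2,
  Lemma 2.3 / §5 (sampling `D_{Λ+c,r}` efficiently). [BrakerskiEtAl2013]
* C. Gentry, C. Peikert, V. Vaikuntanathan, *Trapdoors for hard lattices and new cryptographic
  constructions*, STOC 2008, §4.1 (`D_{ℤⁿ,s,c}` coordinate by coordinate). [GentryPeikertVaikuntanathan2008]
-/

noncomputable section

open MeasureTheory ProbabilityTheory Literature.Algebra.EuclideanLattices Literature.Probability.Distributions
open scoped Real ENNReal NNReal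

namespace Literature.Computability.Cryptography

namespace BLPRS2013

/-! ### The continuous part of one switched sample and its rounding -/

section Cont

variable (Q q' : ℕ) [NeZero Q] [NeZero q']

/-- **The joint law of the jitter and the total continuous noise** of one switched sample: `u ← U[-½,½)`,
`w ← D_σ` independent. [cite: BrakerskiEtAl2013, Lemma 3.5 (the map) with RegevLWE2009, Lemma 4.3] -/
def contNoise (σ : ℝ) : Measure (ℝ × ℝ) :=
  LWE.unitUniform.prod (gaussianReal 0 (Real.toNNReal (σ ^ 2 / (2 * π))))

/-- `contNoise` is a probability measure. [folklore] -/
instance isProbabilityMeasure_contNoise (σ : ℝ) : IsProbabilityMeasure (contNoise σ) := by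
  unfold contNoise; infer_instance

/-- **The rounded continuous part**: `(u, w) ↦ ⌊c + q'u/Q + q'w⌉ mod q'`. [cite: RegevLWE2009, Lemma 4.3 (discretisation `⌊q·⌉`)] -/
def roundMap (c : ℝ) (p : ℝ × ℝ) : ZMod q' :=
  ((round (c + (q' : ℝ) * p.1 / Q + (q' : ℝ) * p.2) : ℤ) : ZMod q')

/-- `round` is measurable (a private copy of the tree's `measurable_round_real`,
`QuantumComplexity/ApproxBosonSamplingIdealSide.lean`, to spare the import). [folklore] -/
private theorem measurable_round : Measurable (round : ℝ → ℤ) := by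
  have : (round : ℝ → ℤ) = fun x => ⌊x + 1 / 2⌋ := funext round_eq
  rw [this]
  exact Int.measurable_floor.comp (measurable_id.add_const _)

omit [NeZero Q] [NeZero q'] in
/-- `roundMap` is measurable. [folklore] -/
theorem measurable_roundMap (c : ℝ) : Measurable (roundMap Q q' c) := by
  unfold roundMap
  refine (measurable_from_top (f := fun z : ℤ => (z : ZMod q'))).comp (measurable_round.comp ?_)
  exact ((measurable_const.add ((measurable_fst.const_mul _).div_const _)).add (measurable_snd.const_mul _))

/-- **The law of the rounded continuous part**, as a `PMF` on `ℤ_{q'}`. [cite: RegevLWE2009, Lemma 4.3] -/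
def roundLaw (c σ : ℝ) : PMF (ZMod q') :=
  haveI : IsProbabilityMeasure ((contNoise σ).map (roundMap Q q' c)) :=
    Measure.isProbabilityMeasure_map (measurable_roundMap Q q' c).aemeasurable
  ((contNoise σ).map (roundMap Q q' c)).toPMF

omit [NeZero Q] in
/-- The measure of `roundLaw` is the push-forward of `contNoise`. [folklore] -/
theorem toMeasure_roundLaw (c σ : ℝ) : (roundLaw Q q' c σ).toMeasure = (contNoise σ).map (roundMap Q q' c) := by
  rw [roundLaw, Measure.toPMF_toMeasure]

end Cont

/-! ### The recipe -/

section Recipe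

variable (n Q q' : ℕ) [NeZero Q] [NeZero q'] (r B τ : ℝ) (t : Fin n → ZMod q')

/-- **The sampling recipe of one switched sample** `(a, b̄) ↦ (a', b̄')`:
`kⱼ ← D_{ℤ,q'r,q'aⱼ/Q}`, `a' = k mod q'`, `b̄' = ⟨a', t⟩ + ⌊q'b̄/Q + q'u/Q + q'w⌉`, `(u, w) ← contNoise`.
[cite: BrakerskiEtAl2013, Lemma 3.5 (the map) with Cor. 3.2; GentryPeikertVaikuntanathan2008, §4.1] -/
def samplingPMF (p : (Fin n → ZMod Q) × ZMod Q) : PMF ((Fin n → ZMod q') × ZMod q') :=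
  (indepLaw n fun j => discreteGaussianInt ((q' : ℝ) * r) ((q' : ℝ) * (((p.1 j).val : ℝ) / Q))).bind fun k =>
    (roundLaw Q q' ((q' : ℝ) * ((p.2.val : ℝ) / Q)) (Real.sqrt ((r * B) ^ 2 + τ ^ 2))).map fun z =>
      (fun j => (k j : ZMod q'), (fun j => (k j : ZMod q')) ⬝ᵥ t + z)

end Recipe

/-! ### The grid `q'⁻¹ℤⁿ`: numerators and classes of grid vectors -/

section Grid

variable (n q' : ℕ) [NeZero q']

/-- The numerators of `k/q'` are `k`. [folklore] -/
theorem num_fineGridEquiv (k : Fin n → ℤ) (j : Fin n) : num n q' (fineGridEquiv n q' k) j = k j := by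
  have h := num_spec n q' (fineGridEquiv n q' k) j
  rw [coe_fineGridEquiv, fineGridVec_apply, mul_div_cancel₀ _ (NeZero.ne (q' : ℝ))] at h
  exact_mod_cast h

/-- **The class of `k/q'` in `ℤ_{q'}ⁿ` is `k mod q'`.** [cite: BrakerskiEtAl2013, §2.3 (`𝕋_qⁿ ≅ ℤ_qⁿ`)] -/
theorem torusClass_fineGridEquiv (k : Fin n → ℤ) : torusClass n q' (fineGridEquiv n q' k) = fun j => (k j : ZMod q') := by
  funext j
  rw [torusClass, num_fineGridEquiv]

end Grid

/-! ### The torus arithmetic of the chain collapses to the recipe -/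

section Arith

variable (Q q' : ℕ) [NeZero Q] [NeZero q'] {n : ℕ} (t : Fin n → ZMod q')

omit [NeZero Q] in
/-- **On a switched sample, discretisation reads the recipe**: for `i ∈ ℤ_{q'}ⁿ`, jitter `u`, total noise `w`,
`discretizeCircle(↑((b̄+u)/Q) + ↑w + ↑((⟨i,t⟩ mod q')/q')) = ⟨i,t⟩ + ⌊q'b̄/Q + q'u/Q + q'w⌉`.
[cite: RegevLWE2009, Lemma 4.3 with Lemma 4.1 (proof: the shift `⟨a,t⟩`)] -/
theorem discretize_recipe (b : ZMod Q) (i : Fin n → ZMod q') (u w : ℝ) :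
    LWE.discretizeCircle q' ((((((b.val : ℝ) + u) / Q : ℝ)) : UnitAddCircle) + ((w : ℝ) : UnitAddCircle) + rsrPhase n q' t i) =
      i ⬝ᵥ t + roundMap Q q' ((q' : ℝ) * ((b.val : ℝ) / Q)) (u, w) := by
  have hq : (q' : ℝ) ≠ 0 := by exact_mod_cast NeZero.ne q'
  rw [rsrPhase, ← AddCircle.coe_add, ← AddCircle.coe_add,
    show ((b.val : ℝ) + u) / Q + w + (((i ⬝ᵥ t).val : ℝ) / q') = (((i ⬝ᵥ t).val : ℝ) / q') + (((b.val : ℝ) + u) / Q + w) by ring,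
    LWE.discretizeCircle_coe, LWE.discretize_natCast_div_add, ZMod.natCast_zmod_val]
  congr 1
  unfold LWE.discretize roundMap
  congr 2
  field_simp

end Arith

/-! ### The sampling form of the point kernel -/

section Main

variable {n Q q' : ℕ} [NeZero Q] [NeZero q'] {r B τ : ℝ} {t : Fin n → ZMod q'}

/-- **The point kernel in sampling form** (`0 < r`): `switchPoint (a, b̄) = (samplingPMF (a, b̄)).toMeasure`.
[cite: BrakerskiEtAl2013, Lemma 3.5 (the map) and Cor. 3.2; GentryPeikertVaikuntanathan2008, §4.1] -/
theorem switchPoint_eq_samplingPMF (hr : 0 < r) (p : (Fin n → ZMod Q) × ZMod Q) :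
    switchPoint n Q q' r B τ t p = (samplingPMF n Q q' r B τ t p).toMeasure := by
  obtain ⟨a, b⟩ := p
  have hq : (0 : ℝ) < q' := by exact_mod_cast Nat.pos_of_ne_zero (NeZero.ne q')
  -- abbreviations
  set Nτ : Measure ℝ := gaussianReal 0 (Real.toNNReal (τ ^ 2 / (2 * π))) with hNτ
  set σ : ℝ := Real.sqrt ((r * B) ^ 2 + τ ^ 2) with hσ
  -- the continuous noises merge: `D_{rB} ∗ D_τ = D_σ`
  have hconv : addedNoise r B ∗ Nτ = gaussianReal 0 (Real.toNNReal (σ ^ 2 / (2 * π))) := by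
    rw [addedNoise, hNτ, gaussianReal_conv_gaussianReal, add_zero, hσ, Real.sq_sqrt (by positivity),
      ← Real.toNNReal_add (by positivity) (by positivity), ← add_div]
  ext S hS
  -- unfold the chain on the left
  have hT : MeasurableSet (LWE.discretizeSample q' ⁻¹' S) := LWE.measurable_discretizeSample q' hS
  set T := LWE.discretizeSample (ι := Fin n) q' ⁻¹' S with hTdef
  have hf : Measurable fun y : (Fin n → ZMod q') × UnitAddCircle => postKernel n q' τ t y T :=
    (Measure.measurable_coe hT).comp measurable_postKernel
  have hK : Measurable fun z : (Fin n → ZMod Q) × UnitAddCircle => ∫⁻ y, postKernel n q' τ t y T ∂(modSwitchKernel n Q q' r B z) :=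
    (Measure.measurable_lintegral hf).comp (measurable_modSwitchKernel r B)
  rw [switchPoint, switchDisc, Measure.map_apply (LWE.measurable_discretizeSample q') hS, ← hTdef, postOutput,
    Measure.bind_apply hT measurable_postKernel.aemeasurable, modSwitchOutput,
    Measure.lintegral_bind (measurable_modSwitchKernel r B).aemeasurable hf.aemeasurable, LWE.recontKernel,
    lintegral_map hK (LWE.measurable_mk_recontPhase Q a b)]
  -- the inner integral against the switch kernel, for a fixed jitter `u`
  have hinner : ∀ u : ℝ, ∫⁻ y, postKernel n q' τ t y T ∂(modSwitchKernel n Q q' r B (a, LWE.recontPhase Q b u)) =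
      ∑' x : invScaledIntLattice n q', discreteGaussian (invScaledIntLattice n q') r (torusRep n Q a) x *
        ∫⁻ e', Nτ {g : ℝ | (torusClass n q' x, LWE.recontPhase Q b u + ((e' : ℝ) : UnitAddCircle) +
          rsrPhase n q' t (torusClass n q' x) + ((g : ℝ) : UnitAddCircle)) ∈ T} ∂(addedNoise r B) := by
    intro u
    rw [modSwitchKernel, lintegral_sum_measure]
    refine tsum_congr fun x => ?_
    rw [lintegral_smul_measure, lintegral_map hf (measurable_mk_add_coe _ _)]
    congr 1
    refine lintegral_congr fun e' => ?_
    rw [postKernel_apply _ hT, LWE.wrappedGaussian, ← hNτ,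
      Measure.map_apply LWE.measurable_coe_unitAddCircle]
    · rfl
    · exact (measurable_const.prodMk (measurable_const.add measurable_id)) hT
  simp_rw [hinner]
  -- the double Gaussian integral is the merged Gaussian on a section
  have hsec : ∀ (u : ℝ) (x : invScaledIntLattice n q'),
      ∫⁻ e', Nτ {g : ℝ | (torusClass n q' x, LWE.recontPhase Q b u + ((e' : ℝ) : UnitAddCircle) +
          rsrPhase n q' t (torusClass n q' x) + ((g : ℝ) : UnitAddCircle)) ∈ T} ∂(addedNoise r B) =
        gaussianReal 0 (Real.toNNReal (σ ^ 2 / (2 * π)))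
          {w : ℝ | (torusClass n q' x, LWE.recontPhase Q b u + ((w : ℝ) : UnitAddCircle) + rsrPhase n q' t (torusClass n q' x)) ∈ T} := by
    intro u x
    set i := torusClass n q' x with hi
    set W : Set ℝ := {w : ℝ | (i, LWE.recontPhase Q b u + ((w : ℝ) : UnitAddCircle) + rsrPhase n q' t i) ∈ T} with hW
    have hWm : MeasurableSet W :=
      (measurable_const.prodMk ((measurable_const.add LWE.measurable_coe_unitAddCircle).add measurable_const)) hT
    have hpre : ∀ e' : ℝ, {g : ℝ | (i, LWE.recontPhase Q b u + ((e' : ℝ) : UnitAddCircle) + rsrPhase n q' t i +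
        ((g : ℝ) : UnitAddCircle)) ∈ T} = Prod.mk e' ⁻¹' ((fun z : ℝ × ℝ => z.1 + z.2) ⁻¹' W) := by
      intro e'
      ext g
      simp only [hW, Set.mem_preimage, Set.mem_setOf_eq, AddCircle.coe_add]
      rw [show LWE.recontPhase Q b u + (e' : UnitAddCircle) + rsrPhase n q' t i + (g : UnitAddCircle) =
        LWE.recontPhase Q b u + ((e' : UnitAddCircle) + (g : UnitAddCircle)) + rsrPhase n q' t i by abel]
    simp_rw [hpre]
    rw [← Measure.prod_apply (measurable_add hWm), ← Measure.map_apply measurable_add hWm]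
    change (addedNoise r B ∗ Nτ) W = _
    rw [hconv]
  simp_rw [hsec]
  -- swap the sum over the lattice and the jitter integral
  have hterm : ∀ x : invScaledIntLattice n q', Measurable fun u : ℝ =>
      discreteGaussian (invScaledIntLattice n q') r (torusRep n Q a) x *
        gaussianReal 0 (Real.toNNReal (σ ^ 2 / (2 * π)))
          {w : ℝ | (torusClass n q' x, LWE.recontPhase Q b u + ((w : ℝ) : UnitAddCircle) + rsrPhase n q' t (torusClass n q' x)) ∈ T} := by
    intro x
    refine Measurable.const_mul ?_ _
    have hV : MeasurableSet {z : ℝ × ℝ | (torusClass n q' x, LWE.recontPhase Q b z.1 + ((z.2 : ℝ) : UnitAddCircle) +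
        rsrPhase n q' t (torusClass n q' x)) ∈ T} :=
      (measurable_const.prodMk (((LWE.measurable_recontPhase Q b).comp measurable_fst).add
        (LWE.measurable_coe_unitAddCircle.comp measurable_snd) |>.add measurable_const)) hT
    exact measurable_measure_prodMk_left hV
  rw [lintegral_tsum fun x => (hterm x).aemeasurable]
  -- the jitter integral of a section is the product measure `contNoise`
  have hprod : ∀ x : invScaledIntLattice n q',
      ∫⁻ u, discreteGaussian (invScaledIntLattice n q') r (torusRep n Q a) x *
          gaussianReal 0 (Real.toNNReal (σ ^ 2 / (2 * π)))
            {w : ℝ | (torusClass n q' x, LWE.recontPhase Q b u + ((w : ℝ) : UnitAddCircle) + rsrPhase n q' t (torusClass n q' x)) ∈ T}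
          ∂LWE.unitUniform =
        discreteGaussian (invScaledIntLattice n q') r (torusRep n Q a) x *
          contNoise σ {z : ℝ × ℝ | (torusClass n q' x, (torusClass n q' x) ⬝ᵥ t + roundMap Q q' ((q' : ℝ) * ((b.val : ℝ) / Q)) z) ∈ S} := by
    intro x
    have hV : MeasurableSet {z : ℝ × ℝ | (torusClass n q' x, LWE.recontPhase Q b z.1 + ((z.2 : ℝ) : UnitAddCircle) +
        rsrPhase n q' t (torusClass n q' x)) ∈ T} :=
      (measurable_const.prodMk (((LWE.measurable_recontPhase Q b).comp measurable_fst).add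
        (LWE.measurable_coe_unitAddCircle.comp measurable_snd) |>.add measurable_const)) hT
    have hV' : MeasurableSet {z : ℝ × ℝ | (torusClass n q' x, (torusClass n q' x) ⬝ᵥ t +
        roundMap Q q' ((q' : ℝ) * ((b.val : ℝ) / Q)) z) ∈ S} :=
      (measurable_const.prodMk (measurable_const.add (measurable_roundMap Q q' _))) hS
    have hmu : Measurable fun u : ℝ => gaussianReal 0 (Real.toNNReal (σ ^ 2 / (2 * π)))
        {w : ℝ | (torusClass n q' x, LWE.recontPhase Q b u + ((w : ℝ) : UnitAddCircle) + rsrPhase n q' t (torusClass n q' x)) ∈ T} :=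
      measurable_measure_prodMk_left hV
    rw [lintegral_const_mul _ hmu, contNoise, Measure.prod_apply hV']
    congr 1
    refine lintegral_congr fun u => ?_
    congr 1
    ext w
    simp only [Set.mem_setOf_eq, hTdef, Set.mem_preimage, LWE.discretizeSample, Prod.map_apply, id_eq]
    rw [LWE.recontPhase, discretize_recipe Q q' t b (torusClass n q' x) u w]
  simp_rw [hprod]
  -- the right-hand side: unfold the recipe
  have hmeasφ : ∀ k : Fin n → ℤ, Measurable fun z : ZMod q' =>
      ((fun j => (k j : ZMod q')), (fun j => (k j : ZMod q')) ⬝ᵥ t + z) := fun k => measurable_of_countable _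
  rw [samplingPMF, PMF.toMeasure_bind_apply _ _ _ hS]
  simp_rw [PMF.toMeasure_map_apply _ _ _ (hmeasφ _) hS, toMeasure_roundLaw,
    Measure.map_apply (measurable_roundMap Q q' _) ((hmeasφ _) hS)]
  -- reindex the lattice sum by the numerators `k`
  rw [← (fineGridEquiv n q').tsum_eq]
  refine tsum_congr fun k => ?_
  have hk : ((fineGridEquiv n q').toEquiv : (Fin n → ℤ) ≃ invScaledIntLattice n q') k = fineGridEquiv n q' k := rfl
  rw [hk]
  have hD : discreteGaussian (invScaledIntLattice n q') r (torusRep n Q a) (fineGridEquiv n q' k) =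
      indepLaw n (fun j => discreteGaussianInt ((q' : ℝ) * r) ((q' : ℝ) * (((a j).val : ℝ) / Q))) k := by
    have h := discreteGaussian_fineGrid_eq_map (N := q') hr (torusRep n Q a)
    change discreteGaussian (invScaledIntLattice n q') r (torusRep n Q a) = _ at h
    rw [h, show ⇑(fineGridEquiv n q') = fun k => fineGridEquiv n q' k from rfl,
      LWE.pmf_map_apply_of_injective _ (fineGridEquiv n q').injective]
    simp only [torusRep_apply]
  rw [hD, torusClass_fineGridEquiv]
  rfl

/-- **The reduction's kernel on a tuple of samples is the product of the recipes.** [cite: BrakerskiEtAl2013, Cor. 3.2] -/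
theorem switchKernelPMF_eq (hr : 0 < r) (m : ℕ) (S : Fin m → (Fin n → ZMod Q) × ZMod Q) :
    switchKernelPMF n Q q' r B τ t m S = piLaw fun i => samplingPMF n Q q' r B τ t (S i) := by
  apply PMF.toMeasure_injective
  rw [switchKernelPMF, Measure.toPMF_toMeasure, piKernel, toMeasure_piLaw]
  congr 1
  funext i
  exact switchPoint_eq_samplingPMF hr (S i)

end Main

end BLPRS2013

end Literature.Computability.Cryptography

end
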